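import Literature.AnabelianGeometry.SemiGraphs.SurfaceTypeCuspQuotients
import Literature.AnabelianGeometry.SemiGraphs.BranchSubgroupLemmas
import Literature.AnabelianGeometry.Anabelioids.AutOfEquivalence
import Literature.AnabelianGeometry.Anabelioids.BCatBranchConjugacy
import Literature.AnabelianGeometry.Anabelioids.ExactFunctorProofs
import Literature.GroupTheory.CombinatorialGroupTheory.PuncturedSurfaceGroupMixedCuspQuotients
import Literature.GroupTheory.CombinatorialGroupTheory.PuncturedSurfaceGroupElevationQuotients

/-!
# Mixed branch-order open normal subgroups of a surface-type vertex group ([SemiAnbd] Rmk. 2.10.1)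

Mochizuki, *Semi-graphs of anabelioids*, Publ. RIMS **42** (2006), Example 2.10 p. 31 (surface type:
`Π_v` the pro-`Σ` completion of a hyperbolic surface group, `Π_b ⊆ Π_v` a cusp inertia group) and
Remark 2.10.1 p. 32 (`C_{Π_𝒢}(Π_b) = Π_b`, "using exactly the same techniques as … Proposition 2.6,
Corollary 2.7") [cite: MochizukiSemiAnbd2006, Rem. 2.10.1 p.32].  The coverings those techniques glue
need, at a surface-type vertex `v`, finite quotients `Π_v ↠ Π_v/W` in which the branch groups of a
prescribed set `Zb` of branches DIE while every other branch group has image EXACTLY `ℤ/n`.  This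
proof-only file (cell abc-iut, layer L3, row F-1477, seat abc-iut-L3-t12) supplies them over
abc-iut-L3-t1's `IsOfSurfaceType` from `PuncturedSurfaceGroup.exists_normal_mixed`:
`IsProSigmaCompletion.exists_open_normal_mixed` (completion level);
`IsOfSurfaceType.exists_open_normal_mixed_or_obstructed` (EITHER such a `W ⊴ Π_v`, open normal of
index dividing `n ^ 3`, `Π_b ≤ W` for `b ∈ Zb`, `W ∩ Π_b = (n-th powers)⁻` and `Π_b ⊄ W` otherwise, OR
the INTRINSIC OBSTRUCTION: every open normal subgroup containing the `Zb`-branch groups is `Π_v` — a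
genus-`0` vertex all but one of whose cusps are in `Zb`); `…_of_two_branches` / `…_of_subsingleton`
(no obstruction when two branches lie outside `Zb`, or `Zb` has at most one element);
`comap_branch_eq_range_pow` (the pull-back of such a `W` to `Π_e` along `Π_e → Π_b ⊆ Π_v` is EXACTLY
the set of `n`-th powers of `Π_e` — intrinsic, hence the same from both ends of the edge);
`PuncturedSurfaceGroup.not_isOfFinOrder_c` (cusp generators have infinite order).
No statement here takes a side on any disputed claim; nothing about [IUTchIII] Cor. 3.12.
-/

/-! ### Cusp generators have infinite order -/

namespace Literature.GroupTheory.CombinatorialGroupTheory.PuncturedSurfaceGroup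

/-- **The cusp generators of a hyperbolic punctured surface group have infinite order** — witnessed by
a quotient in which `c_j` has infinite order (`ℤ` via a second cusp in genus `0`, the integral
Heisenberg group in positive genus). [cite: MochizukiSemiAnbd2006, Ex. 2.10 p.31] -/
theorem not_isOfFinOrder_c {g r : ℕ} (h : IsHyperbolicType g r) (j : Fin r) :
    ¬ IsOfFinOrder (c j : PuncturedSurfaceGroup g r) := by
  have key : ∃ (Q : Type) (_ : Group Q) (f : PuncturedSurfaceGroup g r →* Q), orderOf (f (c j)) = 0 := by
    by_cases hg : g = 0
    · subst hg
      have hr : 2 ≤ r := by unfold IsHyperbolicType at h; omega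
      haveI : Nontrivial (Fin r) := Fin.nontrivial_iff_two_le.mpr hr
      obtain ⟨j', hj'⟩ := exists_ne j
      obtain ⟨φ, hφ, -, -⟩ := exists_hom_pair (g := 0) j j' hj'.symm 0
      refine ⟨_, inferInstance, φ, ?_⟩
      rw [hφ, orderOf_ofAdd_eq_addOrderOf, ZMod.addOrderOf_one]
    · obtain ⟨σ, f, hf, -⟩ := exists_hom_single_cusp (r := r) (Nat.pos_of_ne_zero hg) j 0
      exact ⟨_, inferInstance, f, hf⟩
  obtain ⟨Q, _, f, hf⟩ := key
  intro hfin
  have h1 := orderOf_map_dvd f (c j)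
  rw [hf, zero_dvd_iff] at h1
  exact (orderOf_pos_iff.mpr hfin).ne' h1

end Literature.GroupTheory.CombinatorialGroupTheory.PuncturedSurfaceGroup

/-! ### Completion level -/

namespace Literature.AnabelianGeometry.SemiGraphs.SemiGraphOfAnabelioids.IsProSigmaCompletion

open Literature.AnabelianGeometry.Anabelioids Topology
open Literature.GroupTheory.CombinatorialGroupTheory
open Literature.GroupTheory.CombinatorialGroupTheory.PuncturedSurfaceGroup

variable {Sigma : Set ℕ} {g r : ℕ} {P : Type*} [Group P] [TopologicalSpace P]
  [IsTopologicalGroup P] {ι : PuncturedSurfaceGroup g r →* P}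

/-- **Mixed cusp-order open normal subgroups of a pro-`Σ` surface group.** For `ι : Γ_{g,r} → P` a
pro-`Σ` completion, a `Σ`-integer `n`, and disjoint sets of cusps `Z` (to be killed) and `R` (to get
order exactly `n`) not in the obstructed position, there is an open normal `W ⊴ P` of index dividing
`n ^ 3` with `ι(c_j) ∈ W` for `j ∈ Z` and, for `j ∈ R`, `ι⁻¹(W) ∩ ⟨c_j⟩ = ⟨c_j ^ n⟩` and
`W ∩ (ι⟨c_j⟩)⁻ = (ι⟨c_j ^ n⟩)⁻`. [cite: MochizukiSemiAnbd2006, Rem. 2.10.1 p.32] -/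
theorem exists_open_normal_mixed (hι : IsProSigmaCompletion Sigma ι) {n : ℕ}
    (hn : IsSigmaInteger Sigma n) (Z R : Finset (Fin r)) (hZR : Disjoint Z R)
    (hobs : ¬ (g = 0 ∧ R.card = 1 ∧ Z ∪ R = Finset.univ)) :
    ∃ W : Subgroup P, IsOpen (W : Set P) ∧ W.Normal ∧ W.index ∣ n ^ 3 ∧
      (∀ j ∈ Z, ι (c j) ∈ W) ∧
      ∀ j ∈ R, W.comap ι ⊓ cuspInertia j = Subgroup.zpowers (c j ^ n) ∧
        (W : Set P) ∩
            closure (ι '' ((cuspInertia (g := g) j : Subgroup (PuncturedSurfaceGroup g r)) :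
              Set (PuncturedSurfaceGroup g r))) =
          closure (ι '' ((Subgroup.zpowers (c (g := g) j ^ n) :
            Subgroup (PuncturedSurfaceGroup g r)) : Set (PuncturedSurfaceGroup g r))) := by
  obtain ⟨N, hNn, hNidx, hNZ, hNR⟩ := exists_normal_mixed (g := g) hn.1 Z R hZR hobs
  haveI := hNn
  have hNS : IsSigmaInteger Sigma N.index := by
    refine (hn.mul (hn.mul hn)).of_dvd ?_
    have : n ^ 3 = n * (n * n) := by ring
    rw [← this]; exact hNidx
  obtain ⟨W, hWo, hWN⟩ := hι.comap_surj N hNn hNS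
  have hWn : W.Normal := normal_of_comap_normal hι W hWo (hWN ▸ hNn)
  haveI := hWn
  refine ⟨W, hWo, hWn, ?_, fun j hj => ?_, fun j hj => ⟨?_, ?_⟩⟩
  · rw [← index_comap_of_normal hι W hWo, hWN]; exact hNidx
  · have : c j ∈ W.comap ι := hWN ▸ hNZ j hj
    exact this
  · rw [hWN]; exact hNR j hj
  · rw [inter_closure_image_eq W hWo, inf_comm, hWN, hNR j hj]

/-- **The genus-`0` obstruction, completion level.** If `g = 0` and every cusp but possibly one lies
in `Z`, an open (normal) subgroup of `P` containing the `ι(c_j)`, `j ∈ Z`, is everything.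
[cite: MochizukiSemiAnbd2006, Rem. 2.10.1 p.32] -/
theorem eq_top_of_obstructed {ι : PuncturedSurfaceGroup 0 r →* P}
    (hι : IsProSigmaCompletion Sigma ι) (Z : Finset (Fin r)) (j₀ : Fin r)
    (hZ : ∀ j, j ≠ j₀ → j ∈ Z) (W : Subgroup P) (hWo : IsOpen (W : Set P))
    (hW : ∀ j ∈ Z, ι (c j) ∈ W) : W = ⊤ := by
  have hall : ∀ j, c j ∈ W.comap ι := by
    have hj₀ : c j₀ ∈ W.comap ι := mem_of_forall_ne_mem (W.comap ι) j₀ fun j hj => hW j (hZ j hj)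
    intro j
    by_cases hj : j = j₀
    · rw [hj]; exact hj₀
    · exact hW j (hZ j hj)
  have htop : W.comap ι = (⊤ : Subgroup P).comap ι := by
    rw [eq_top_of_forall_c_mem _ hall, Subgroup.comap_top]
  exact eq_of_comap_eq hι hWo isOpen_univ htop

end Literature.AnabelianGeometry.SemiGraphs.SemiGraphOfAnabelioids.IsProSigmaCompletion

/-! ### At a vertex of surface type -/

namespace Literature.AnabelianGeometry.SemiGraphs.SemiGraphOfAnabelioids

open CategoryTheory CategoryTheory.PreGaloisCategory
open Literature.AnabelianGeometry.Anabelioids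
open Literature.GroupTheory.CombinatorialGroupTheory
open Topology

universe v₁ u₁ u

variable {𝒢 : SemiGraphOfAnabelioids.{v₁, u₁, u}} {Sigma : Set ℕ}

/-- The cusp sets `Z = js(Zb)` and `R = js(Star v ∖ Zb)` of a set of branches. [folklore] -/
private theorem exists_cuspSets {v : 𝒢.graph.Vertex} {r : ℕ} (js : 𝒢.graph.Star v → Fin r)
    (hjs : Function.Injective js) (Zb : Set (𝒢.graph.Star v)) :
    ∃ Z R : Finset (Fin r), Disjoint Z R ∧ (∀ b, b ∈ Zb → js b ∈ Z) ∧ (∀ b, b ∉ Zb → js b ∈ R) ∧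
      (∀ j ∈ Z, ∃ b ∈ Zb, js b = j) ∧ (∀ j ∈ R, ∃ b ∉ Zb, js b = j) := by
  classical
  refine ⟨Finset.univ.filter fun j => ∃ b ∈ Zb, js b = j,
    Finset.univ.filter fun j => ∃ b ∉ Zb, js b = j, ?_, fun b hb => ?_, fun b hb => ?_,
    fun j hj => ?_, fun j hj => ?_⟩
  · rw [Finset.disjoint_left]
    rintro j hjZ hjR
    simp only [Finset.mem_filter, Finset.mem_univ, true_and] at hjZ hjR
    obtain ⟨b, hb, rfl⟩ := hjZ
    obtain ⟨b', hb', hbb'⟩ := hjR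
    exact hb' (hjs hbb' ▸ hb)
  · simp only [Finset.mem_filter, Finset.mem_univ, true_and]; exact ⟨b, hb, rfl⟩
  · simp only [Finset.mem_filter, Finset.mem_univ, true_and]; exact ⟨b, hb, rfl⟩
  · simpa only [Finset.mem_filter, Finset.mem_univ, true_and] using hj
  · simpa only [Finset.mem_filter, Finset.mem_univ, true_and] using hj

/-- The CONSTRUCTION at a vertex of surface type, for given surface data `(g, r, ι, js)` at `v`
([SemiAnbd] Ex. 2.10) and cusp sets `Z ⊇ js(Zb)`, `R ⊇ js(Star v ∖ Zb)`, disjoint and not in the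
obstructed position: an open normal `W ⊴ Π_v` of index dividing `n ^ 3` killing the branch groups of
`Zb` and meeting every other branch group in exactly the closure of its `n`-th powers, properly.
[cite: MochizukiSemiAnbd2006, Rem. 2.10.1 p.32] -/
private theorem exists_open_normal_mixed_core (v : 𝒢.graph.Vertex) (F : 𝒢.V v ⥤ FintypeCat.{v₁})
    [FiberFunctor F] {n : ℕ} (hn : IsSigmaInteger Sigma n) (hn1 : 1 < n) (Zb : Set (𝒢.graph.Star v))
    {g r : ℕ} (ι : PuncturedSurfaceGroup g r →* Aut F) (hh : PuncturedSurfaceGroup.IsHyperbolicType g r)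
    (hι : IsProSigmaCompletion Sigma ι) (js : 𝒢.graph.Star v → Fin r)
    (hbr : ∀ (b : 𝒢.graph.Star v) (Fe : 𝒢.E (𝒢.graph.edgeOf b.1) ⥤ FintypeCat.{v₁}) [FiberFunctor Fe],
      ∃ α : (𝒢.pull b.1 v b.2).pullback ⋙ Fe ≅ F,
        (𝒢.branchSubgroup F b.1 b.2 Fe α : Set (Aut F)) =
          closure (ι '' ((PuncturedSurfaceGroup.cuspInertia (g := g) (js b) :
            Subgroup (PuncturedSurfaceGroup g r)) : Set (PuncturedSurfaceGroup g r))))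
    (Z R : Finset (Fin r)) (hZR : Disjoint Z R)
    (hmemZ : ∀ b : 𝒢.graph.Star v, b ∈ Zb → js b ∈ Z) (hmemR : ∀ b : 𝒢.graph.Star v, b ∉ Zb → js b ∈ R)
    (hobs : ¬ (g = 0 ∧ R.card = 1 ∧ Z ∪ R = Finset.univ)) :
    ∃ W : Subgroup (Aut F), IsOpen (W : Set (Aut F)) ∧ W.Normal ∧ W.index ∣ n ^ 3 ∧
      ∀ (b : 𝒢.graph.Star v) (Fe : 𝒢.E (𝒢.graph.edgeOf b.1) ⥤ FintypeCat.{v₁}) [FiberFunctor Fe],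
        ∃ α : (𝒢.pull b.1 v b.2).pullback ⋙ Fe ≅ F,
          (b ∈ Zb → 𝒢.branchSubgroup F b.1 b.2 Fe α ≤ W) ∧
          (b ∉ Zb →
            (W : Set (Aut F)) ∩ (𝒢.branchSubgroup F b.1 b.2 Fe α : Set (Aut F)) =
              closure ((fun x : Aut F => x ^ n) '' (𝒢.branchSubgroup F b.1 b.2 Fe α : Set (Aut F))) ∧
            ¬ 𝒢.branchSubgroup F b.1 b.2 Fe α ≤ W) := by
  obtain ⟨W, hWo, hWn, hWidx, hWZ, hWR⟩ := hι.exists_open_normal_mixed hn Z R hZR hobs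
  refine ⟨W, hWo, hWn, hWidx, fun b Fe _ => ?_⟩
  obtain ⟨α, hα⟩ := hbr b Fe
  refine ⟨α, fun hb => ?_, fun hb => ⟨?_, ?_⟩⟩
  · -- `b ∈ Zb`: `Π_b = (ι⟨c_j⟩)⁻ ≤ W` since `ι(c_j) ∈ W` and `W` is closed
    intro x hx
    have hx' : x ∈ (𝒢.branchSubgroup F b.1 b.2 Fe α : Set (Aut F)) := hx
    rw [hα] at hx'
    have hsub : ι '' ((PuncturedSurfaceGroup.cuspInertia (g := g) (js b) :
        Subgroup (PuncturedSurfaceGroup g r)) : Set (PuncturedSurfaceGroup g r)) ⊆ (W : Set (Aut F)) := by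
      rintro _ ⟨y, hy, rfl⟩
      obtain ⟨k, rfl⟩ := Subgroup.mem_zpowers_iff.mp hy
      rw [map_zpow]
      exact W.zpow_mem (hWZ _ (hmemZ b hb)) k
    exact closure_minimal hsub (W.isClosed_of_isOpen hWo) hx'
  · rw [hα, (hWR _ (hmemR b hb)).2, PuncturedSurfaceGroup.cuspInertia]
    exact IsProSigmaCompletion.closure_image_zpowers_pow ι _ n
  · -- `Π_b ⊄ W`: otherwise `c_j ∈ ι⁻¹(W) ∩ ⟨c_j⟩ = ⟨c_j ^ n⟩`, so `c_j` would have finite order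
    intro hle
    have hcj : PuncturedSurfaceGroup.c (js b) ∈ W.comap ι ⊓ PuncturedSurfaceGroup.cuspInertia (js b) := by
      refine Subgroup.mem_inf.mpr ⟨?_, Subgroup.mem_zpowers _⟩
      rw [Subgroup.mem_comap]
      apply hle
      show ι (PuncturedSurfaceGroup.c (js b)) ∈ (𝒢.branchSubgroup F b.1 b.2 Fe α : Set (Aut F))
      rw [hα]
      exact subset_closure ⟨_, Subgroup.mem_zpowers _, rfl⟩
    rw [(hWR _ (hmemR b hb)).1, Subgroup.mem_zpowers_iff] at hcj
    obtain ⟨k, hk⟩ := hcj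
    apply PuncturedSurfaceGroup.not_isOfFinOrder_c hh (js b)
    rw [isOfFinOrder_iff_zpow_eq_one]
    refine ⟨n * k - 1, ?_, ?_⟩
    · intro h0
      have hnk : (n : ℤ) * k = 1 := by omega
      have : (n : ℤ) ≤ 1 := Int.le_of_dvd one_pos ⟨k, hnk.symm⟩
      omega
    · rw [zpow_sub_one, zpow_mul, zpow_natCast, hk, mul_inv_cancel]

/-- **Mixed branch-order open normal subgroups, or the intrinsic obstruction.**  Let `𝒢` be of
surface type, `v` a vertex with basepoint `F`, `n > 1` a `Σ`-integer and `Zb` a set of branches at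
`v`.  Then EITHER there is an open normal `W ⊴ Π_v = Aut F` of index dividing `n ^ 3` such that, for
every branch `b` at `v` and every basepoint of `𝒢_e` (with the transport supplied by the surface
structure), `Π_b ≤ W` if `b ∈ Zb`, while `W ∩ Π_b` is the closure of the `n`-th powers of `Π_b` and
`Π_b ⊄ W` if `b ∉ Zb`; OR every open normal subgroup of `Π_v` containing the branch groups of the
branches in `Zb` (for all basepoints and transports) is `Π_v` itself.
[cite: MochizukiSemiAnbd2006, Rem. 2.10.1 p.32] -/
theorem IsOfSurfaceType.exists_open_normal_mixed_or_obstructed (hS : 𝒢.IsOfSurfaceType Sigma)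
    (v : 𝒢.graph.Vertex) (F : 𝒢.V v ⥤ FintypeCat.{v₁}) [FiberFunctor F] {n : ℕ}
    (hn : IsSigmaInteger Sigma n) (hn1 : 1 < n) (Zb : Set (𝒢.graph.Star v)) :
    (∃ W : Subgroup (Aut F), IsOpen (W : Set (Aut F)) ∧ W.Normal ∧ W.index ∣ n ^ 3 ∧
      ∀ (b : 𝒢.graph.Star v) (Fe : 𝒢.E (𝒢.graph.edgeOf b.1) ⥤ FintypeCat.{v₁}) [FiberFunctor Fe],
        ∃ α : (𝒢.pull b.1 v b.2).pullback ⋙ Fe ≅ F,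
          (b ∈ Zb → 𝒢.branchSubgroup F b.1 b.2 Fe α ≤ W) ∧
          (b ∉ Zb →
            (W : Set (Aut F)) ∩ (𝒢.branchSubgroup F b.1 b.2 Fe α : Set (Aut F)) =
              closure ((fun x : Aut F => x ^ n) '' (𝒢.branchSubgroup F b.1 b.2 Fe α : Set (Aut F))) ∧
            ¬ 𝒢.branchSubgroup F b.1 b.2 Fe α ≤ W)) ∨
    (∀ W : Subgroup (Aut F), IsOpen (W : Set (Aut F)) → W.Normal →
      (∀ b : 𝒢.graph.Star v, b ∈ Zb →
        ∀ (Fe : 𝒢.E (𝒢.graph.edgeOf b.1) ⥤ FintypeCat.{v₁}) [FiberFunctor Fe]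
          (α : (𝒢.pull b.1 v b.2).pullback ⋙ Fe ≅ F), 𝒢.branchSubgroup F b.1 b.2 Fe α ≤ W) →
      W = ⊤) := by
  classical
  obtain ⟨g, r, ι, hh, hι, js, hjs, hbr⟩ := hS.vertex v F
  obtain ⟨Z, R, hZR, hmemZ, hmemR, hZ, hR⟩ := exists_cuspSets js hjs Zb
  by_cases hobs : g = 0 ∧ R.card = 1 ∧ Z ∪ R = Finset.univ
  · -- the obstructed position: every open normal `W` containing the `Zb`-groups is everything
    right
    intro W hWo _ hW
    obtain ⟨hg, hR1, hZR'⟩ := hobs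
    subst hg
    obtain ⟨j₀, hRj₀⟩ := Finset.card_eq_one.mp hR1
    refine IsProSigmaCompletion.eq_top_of_obstructed hι Z j₀ (fun j hj => ?_) W hWo (fun j hj => ?_)
    · have : j ∈ Z ∪ R := hZR' ▸ Finset.mem_univ j
      rcases Finset.mem_union.mp this with h | h
      · exact h
      · rw [hRj₀, Finset.mem_singleton] at h; exact absurd h hj
    · obtain ⟨b, hb, rfl⟩ := hZ j hj
      obtain ⟨α, hα⟩ := hbr b (GaloisCategory.getFiberFunctor (𝒢.E (𝒢.graph.edgeOf b.1)))
      have hle := hW b hb (GaloisCategory.getFiberFunctor _) α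
      have hmem : ι (PuncturedSurfaceGroup.c (js b)) ∈
          (𝒢.branchSubgroup F b.1 b.2 (GaloisCategory.getFiberFunctor _) α : Set (Aut F)) := by
        rw [hα]
        exact subset_closure ⟨_, Subgroup.mem_zpowers _, rfl⟩
      exact hle hmem
  · left
    exact exists_open_normal_mixed_core v F hn hn1 Zb ι hh hι js hbr Z R hZR hmemZ hmemR hobs

/-- **Two branches outside `Zb` exclude the obstruction**: if two distinct branches at `v` lie
outside `Zb`, the mixed open normal subgroup of `exists_open_normal_mixed_or_obstructed` exists.
[cite: MochizukiSemiAnbd2006, Rem. 2.10.1 p.32] -/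
theorem IsOfSurfaceType.exists_open_normal_mixed_of_two_branches (hS : 𝒢.IsOfSurfaceType Sigma)
    (v : 𝒢.graph.Vertex) (F : 𝒢.V v ⥤ FintypeCat.{v₁}) [FiberFunctor F] {n : ℕ}
    (hn : IsSigmaInteger Sigma n) (hn1 : 1 < n) (Zb : Set (𝒢.graph.Star v))
    {b₁ b₂ : 𝒢.graph.Star v} (hb₁ : b₁ ∉ Zb) (hb₂ : b₂ ∉ Zb) (hne : b₁ ≠ b₂) :
    ∃ W : Subgroup (Aut F), IsOpen (W : Set (Aut F)) ∧ W.Normal ∧ W.index ∣ n ^ 3 ∧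
      ∀ (b : 𝒢.graph.Star v) (Fe : 𝒢.E (𝒢.graph.edgeOf b.1) ⥤ FintypeCat.{v₁}) [FiberFunctor Fe],
        ∃ α : (𝒢.pull b.1 v b.2).pullback ⋙ Fe ≅ F,
          (b ∈ Zb → 𝒢.branchSubgroup F b.1 b.2 Fe α ≤ W) ∧
          (b ∉ Zb →
            (W : Set (Aut F)) ∩ (𝒢.branchSubgroup F b.1 b.2 Fe α : Set (Aut F)) =
              closure ((fun x : Aut F => x ^ n) '' (𝒢.branchSubgroup F b.1 b.2 Fe α : Set (Aut F))) ∧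
            ¬ 𝒢.branchSubgroup F b.1 b.2 Fe α ≤ W) := by
  classical
  obtain ⟨g, r, ι, hh, hι, js, hjs, hbr⟩ := hS.vertex v F
  obtain ⟨Z, R, hZR, hmemZ, hmemR, hZ, hR⟩ := exists_cuspSets js hjs Zb
  have hobs : ¬ (g = 0 ∧ R.card = 1 ∧ Z ∪ R = Finset.univ) := by
    rintro ⟨-, hR1, -⟩
    have h2 : 1 < R.card :=
      Finset.one_lt_card_iff.mpr ⟨js b₁, js b₂, hmemR b₁ hb₁, hmemR b₂ hb₂, fun h => hne (hjs h)⟩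
    omega
  exact exists_open_normal_mixed_core v F hn hn1 Zb ι hh hι js hbr Z R hZR hmemZ hmemR hobs

/-- **At most one killed branch excludes the obstruction** (hyperbolicity: a genus-`0` vertex has at
least three cusps): if `Zb` has at most one element, the mixed open normal subgroup exists.
[cite: MochizukiSemiAnbd2006, Rem. 2.10.1 p.32] -/
theorem IsOfSurfaceType.exists_open_normal_mixed_of_subsingleton (hS : 𝒢.IsOfSurfaceType Sigma)
    (v : 𝒢.graph.Vertex) (F : 𝒢.V v ⥤ FintypeCat.{v₁}) [FiberFunctor F] {n : ℕ}
    (hn : IsSigmaInteger Sigma n) (hn1 : 1 < n) (Zb : Set (𝒢.graph.Star v))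
    (hZb : Zb.Subsingleton) :
    ∃ W : Subgroup (Aut F), IsOpen (W : Set (Aut F)) ∧ W.Normal ∧ W.index ∣ n ^ 3 ∧
      ∀ (b : 𝒢.graph.Star v) (Fe : 𝒢.E (𝒢.graph.edgeOf b.1) ⥤ FintypeCat.{v₁}) [FiberFunctor Fe],
        ∃ α : (𝒢.pull b.1 v b.2).pullback ⋙ Fe ≅ F,
          (b ∈ Zb → 𝒢.branchSubgroup F b.1 b.2 Fe α ≤ W) ∧
          (b ∉ Zb →
            (W : Set (Aut F)) ∩ (𝒢.branchSubgroup F b.1 b.2 Fe α : Set (Aut F)) =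
              closure ((fun x : Aut F => x ^ n) '' (𝒢.branchSubgroup F b.1 b.2 Fe α : Set (Aut F))) ∧
            ¬ 𝒢.branchSubgroup F b.1 b.2 Fe α ≤ W) := by
  classical
  obtain ⟨g, r, ι, hh, hι, js, hjs, hbr⟩ := hS.vertex v F
  haveI : Finite (𝒢.graph.Star v) := Finite.of_injective js hjs
  obtain ⟨Z, R, hZR, hmemZ, hmemR, hZ, hR⟩ := exists_cuspSets js hjs Zb
  have hobs : ¬ (g = 0 ∧ R.card = 1 ∧ Z ∪ R = Finset.univ) := by
    rintro ⟨hg, hR1, hZR'⟩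
    have hZ1 : Z.card ≤ 1 := by
      rw [Finset.card_le_one]
      intro j hj j' hj'
      obtain ⟨b, hb, rfl⟩ := hZ j hj
      obtain ⟨b', hb', rfl⟩ := hZ j' hj'
      rw [hZb hb hb']
    have hr : r ≤ 2 := by
      have := Finset.card_union_le Z R
      rw [hZR', Finset.card_univ, Fintype.card_fin] at this
      omega
    unfold PuncturedSurfaceGroup.IsHyperbolicType at hh
    omega
  exact exists_open_normal_mixed_core v F hn hn1 Zb ι hh hι js hbr Z R hZR hmemZ hmemR hobs

/-! ### The pull-back of `W` along a branch: an intrinsic subset of `Π_e` -/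

/-- **The pull-back of a mixed subgroup to the edge group is the set of `n`-th powers.**  For `𝒢` of
injective type, a branch `b ∋ v` with basepoints `F`, `F_e` and transport `α`, and a subgroup
`W ⊆ Π_v` meeting the branch group `Π_b = Π_b^{F_e, α}` in exactly the closure of its `n`-th powers,
the pull-back of `W` under `Π_e → Π_b ⊆ Π_v` is exactly the set of `n`-th powers of `Π_e = Aut F_e`
(closed, as the continuous image of a compact group) — an INTRINSIC subset of `Π_e`, hence the same
from both ends of the edge `e`. [cite: MochizukiSemiAnbd2006, Rem. 2.10.1 p.32] -/
theorem comap_branch_eq_range_pow (hinj : 𝒢.IsOfInjectiveType) {v : 𝒢.graph.Vertex}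
    (F : 𝒢.V v ⥤ FintypeCat.{v₁}) [FiberFunctor F] (b : 𝒢.graph.Branch)
    (h : 𝒢.graph.abuts b = some v) (Fe : 𝒢.E (𝒢.graph.edgeOf b) ⥤ FintypeCat.{v₁}) [FiberFunctor Fe]
    (α : (𝒢.pull b v h).pullback ⋙ Fe ≅ F) (W : Subgroup (Aut F)) {n : ℕ}
    (hW : (W : Set (Aut F)) ∩ (𝒢.branchSubgroup F b h Fe α : Set (Aut F)) =
      closure ((fun x : Aut F => x ^ n) '' (𝒢.branchSubgroup F b h Fe α : Set (Aut F)))) :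
    ((W.comap ((Aut.autMulEquivOfIso α).toMonoidHom.comp (𝒢.piBToPiV b v h Fe))) : Set (Aut Fe)) =
      Set.range fun σ : Aut Fe => σ ^ n := by
  set φ : Aut Fe →* Aut F := (Aut.autMulEquivOfIso α).toMonoidHom.comp (𝒢.piBToPiV b v h Fe)
    with hφ
  haveI : FiberFunctor ((𝒢.pull b v h).pullback ⋙ Fe) := fiberFunctor_comp_of_exact _ Fe
  have hcont : Continuous φ := by
    have h1 : Continuous (Aut.autMulEquivOfIso α : Aut ((𝒢.pull b v h).pullback ⋙ Fe) → Aut F) := by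
      have : (Aut.autMulEquivOfIso α : Aut ((𝒢.pull b v h).pullback ⋙ Fe) → Aut F) = α.conjAut := by
        funext f
        rw [Iso.conjAut_apply]
        rfl
      rw [this]
      exact continuous_conjAut_of_iso α
    exact h1.comp (continuous_pi1Map' _ Fe)
  have hφinj : Function.Injective φ :=
    (Aut.autMulEquivOfIso α).injective.comp (hinj.isPi1Mono b v h Fe)
  have hrange : (𝒢.branchSubgroup F b h Fe α : Set (Aut F)) = Set.range φ := by
    rw [branchSubgroup_eq_map_range, Subgroup.coe_map, MonoidHom.coe_range, ← Set.range_comp]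
    rfl
  have himg : (fun x : Aut F => x ^ n) '' (𝒢.branchSubgroup F b h Fe α : Set (Aut F)) =
      φ '' Set.range fun σ : Aut Fe => σ ^ n := by
    rw [hrange]
    ext y
    constructor
    · rintro ⟨_, ⟨σ, rfl⟩, rfl⟩
      exact ⟨σ ^ n, ⟨σ, rfl⟩, (map_pow φ σ n)⟩
    · rintro ⟨_, ⟨σ, rfl⟩, rfl⟩
      exact ⟨φ σ, ⟨σ, rfl⟩, (map_pow φ σ n).symm⟩
  have hclosed : IsClosed (φ '' Set.range fun σ : Aut Fe => σ ^ n) :=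
    (((isCompact_range (continuous_pow n)).image hcont)).isClosed
  ext σ
  rw [SetLike.mem_coe, Subgroup.mem_comap]
  constructor
  · intro hσ
    have hmem : φ σ ∈ (W : Set (Aut F)) ∩ (𝒢.branchSubgroup F b h Fe α : Set (Aut F)) :=
      ⟨hσ, by rw [hrange]; exact ⟨σ, rfl⟩⟩
    rw [hW, himg, hclosed.closure_eq] at hmem
    obtain ⟨τ, hτ, hτσ⟩ := hmem
    rw [← hφinj hτσ]
    exact hτ
  · rintro ⟨τ, rfl⟩
    have hmem : φ (τ ^ n) ∈ (W : Set (Aut F)) ∩ (𝒢.branchSubgroup F b h Fe α : Set (Aut F)) := by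
      rw [hW, himg, hclosed.closure_eq]
      exact ⟨τ ^ n, ⟨τ, rfl⟩, rfl⟩
    exact hmem.1

/-- **A killed branch pulls back to everything**: if `Π_b ≤ W` then the pull-back of `W` under
`Π_e → Π_b ⊆ Π_v` is all of `Π_e`. [cite: MochizukiSemiAnbd2006, Rem. 2.10.1 p.32] -/
theorem comap_branch_eq_top {v : 𝒢.graph.Vertex} (F : 𝒢.V v ⥤ FintypeCat.{v₁}) (b : 𝒢.graph.Branch)
    (h : 𝒢.graph.abuts b = some v) (Fe : 𝒢.E (𝒢.graph.edgeOf b) ⥤ FintypeCat.{v₁})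
    (α : (𝒢.pull b v h).pullback ⋙ Fe ≅ F) (W : Subgroup (Aut F))
    (hW : 𝒢.branchSubgroup F b h Fe α ≤ W) :
    W.comap ((Aut.autMulEquivOfIso α).toMonoidHom.comp (𝒢.piBToPiV b v h Fe)) = ⊤ := by
  rw [eq_top_iff]
  intro σ _
  rw [Subgroup.mem_comap]
  exact hW ((𝒢.mem_branchSubgroup_iff F b h Fe α _).mpr ⟨σ, rfl⟩)

end Literature.AnabelianGeometry.SemiGraphs.SemiGraphOfAnabelioids
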